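import Summits.QuantumFields.BalabanUV.Beta.EriceRemainderEnclosureHistoryAutonomyComparisonDualContraction

/-!
# EriceRemainderEnclosureHistoryAutonomyComparisonMarkovCreditLinks — (E139a) **BRICKS OF THE MARKOV CREDIT: the base family is DAMPED by a lower slope of the
# memory in the CURRENT level (`markov_gap_step`, `markov_gap_le`: two base orbits from ordered pins have their level gap contracted by `(1+μ)⁻¹` per scale), the
# WINDOW GAPS along one perturbed orbit are bounded by the DAMPED positive parts of the dual steps (`gap_le_sum_damped`), a non-negative dual step is AT MOST
# `E_n ∕ (1+μ)` once comparison holds below it (`credit_step_le`), and EVERY memory whose graded level profile has age moment `< 1` deep enough in the box has its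
# dual steps non-negative from some depth on (`deep_steps_nonneg`: (E138b) `dual_steps_sandwich` on the box shifted to a deep pin).**  The comparison theorem with
# Markov credit is (E139b) `…ComparisonMarkovCredit`.

WHY (successor item (α‴) of `HOME/b2b-balaban-beta-d4-p2/g106/README.md` §4).  (E138) bounds the steepness of the comparison column by the age moment `Σ_k k·Λ_k ≤ 1`
of a level-Lipschitz profile; memories that are steep where the orbit passes were observed to compare when they are ALSO steep below («credit»).  Numerically
(g107 `kit/scan107.py`) the blanket form of (α‴) is FALSE — `β₀ + L·u_J^{2r}` and `β₀ + L·e^{−κ∕u_J²}` with a constant excess FAIL comparison for large `L` — and the one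
credit that is provably exact is the MARKOV one: a lower slope `μ` of `B` in the level of age `0` makes every row's dual step `≤ E∕(1+μ)` and damps the base family by
`(1+μ)⁻¹` per scale, so the row condition becomes `Σ_{k≥1} Λ_k·Σ_{j=1}^{k}(1+μ)^{−j} ≤ 1` (sharp: the hinge at age `L` over a Markov pedestal fails iff
`M̃·(1 − (1+s)^{−L})∕s > 1`, g107 `kit/pedestal107.py`).  Slopes are read on the GRADED BOX ABOVE A LEVEL `A` (`a_k ≥ A + (k+1)·b`), `A` the current level of the
orbit, so that profiles decaying with the level are used where the orbit is — a uniform positive Markov slope on the whole box is incompatible with the floor.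

Cell `pub-balaban`, β-function sub-cell, BINDER row D4 «RemainderConst leaves for Bałaban's split» (`HOME/BINDER-OWNERS.md`; owner lineage `b2b-balaban-beta-an4`;
this file by co-owner #2 lineage `b2b-balaban-beta-d4-p2`, generation 107), β-FLOW TEAM duty (1), FREEZE (0) honoured (def-free; (E138b) `dual_steps_sandwich`, (E138a)
`dual_step_eq_levels` ∕ `level_ge_pin_add`, (E132) `cmp_of_dual_steps_nonneg` ∕ `base_gap_damped`, (E49j) `seqBox_mono` ∕ `seqBox_of_le_pin`, (E48a) `family_zero` ∕
`family_mem` ∕ `family_tail_eq` ∕ `le_of_pin_le` ∕ `le_pin_of_memFlow` ∕ `memFlow_tail` ∕ `strictAnti_of_memFlow` BY NAME; nothing restated).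

HONEST FRAMING (page 1, verbatim and binding).  *"Discharging BetaPertH makes Bałaban's UV stability UNCONDITIONAL — a real constructive-QFT result; it is
NOT the continuum limit and NOT the Clay problem."*  THIS FILE DISCHARGES NOTHING OF THE KIND.  Elementary real analysis about ABSTRACT functionals on a box
]0,γ]^ℕ (node U2's `MemFlow` ∕ `SeqBox`) — hypotheses of a census, not facts; nothing about Bałaban's (1.22) limit functional is PRINTED in this form ([I] p. 298;
GAPS G-t4-U2-1∕-2) or asserted.  Row D4 class UNCHANGED (critical-path width 0; instance 0∕1; D4 DISCHARGE NO DATE).  NOT B12 Thm 2, NOT BetaPertH, NOT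
continuum YM, NOT Clay.

WHAT IS PROVED ([folklore]; 0 `def`, 0 sorry).  §1 `level_le_pin_add`.  §2 **`markov_gap_step`**, **`markov_gap_le`**.  §3 **`gap_le_sum_damped`**.  §4 **`credit_step_le`**.
§5 `exists_deep_row`, **`deep_steps_nonneg`**.
-/

noncomputable section
open Finset Set

namespace Summit.QuantumFields.BalabanUV.Beta.EriceRemainderEnclosureHistoryAutonomyComparisonMarkovCreditLinks

open Literature.MathematicalPhysics.QuantumFieldTheory.Balaban1983to89
open Literature.MathematicalPhysics.QuantumFieldTheory.Balaban1983to89.T4BetaStationary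
open Literature.MathematicalPhysics.QuantumFieldTheory.Balaban1983to89.T4BetaFlowWellPosed
open Summit.QuantumFields.BalabanUV.Beta.EriceRemainderEnclosureHistoryAutonomyOrder
  (family_zero family_mem family_tail_eq le_of_pin_le le_pin_of_memFlow memFlow_tail strictAnti_of_memFlow)
open Summit.QuantumFields.BalabanUV.Beta.EriceRemainderEnclosureHistoryAutonomyComparisonExcess (seqBox_mono seqBox_of_le_pin)
open Summit.QuantumFields.BalabanUV.Beta.EriceRemainderEnclosureHistoryAutonomyComparisonDualOrbit (cmp_of_dual_steps_nonneg base_gap_damped)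
open Summit.QuantumFields.BalabanUV.Beta.EriceRemainderEnclosureHistoryAutonomyComparisonDualContractionLinks (level_ge_pin_add dual_step_eq_levels)
open Summit.QuantumFields.BalabanUV.Beta.EriceRemainderEnclosureHistoryAutonomyComparisonDualComparison (level_ge_floor)
open Summit.QuantumFields.BalabanUV.Beta.EriceRemainderEnclosureHistoryAutonomyComparisonDualContraction (dual_steps_sandwich)

variable {B B' : (ℕ → ℝ) → ℝ} {M γ b βb : ℝ} {S : ℝ → ℕ → ℝ} {h h' : ℕ → ℝ} {μ : ℝ → ℝ}

/-! ## §1 Levels grow by at most the ceiling of the memory -/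

/-- Along a box solution of a functional bounded by `β̄` on the box, the level grows by at most `β̄` per scale FROM THE PIN: `1∕h_m² ≤ 1∕q² + m·β̄`. [folklore] -/
theorem level_le_pin_add (hbddB : ∀ u, SeqBox γ u → B u ≤ βb) (hh : SeqBox γ h) {q : ℝ} (hf : MemFlow B q h) :
    ∀ m : ℕ, 1 / h m ^ 2 ≤ 1 / q ^ 2 + (m : ℝ) * βb
  | 0 => by simp [hf.1]
  | m + 1 => by
    have ih := level_le_pin_add hbddB hh hf m
    rw [hf.2 m]; push_cast
    linarith [hbddB _ (seqBox_shift hh (m + 1))]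

/-! ## §2 Markov damping of the base family -/

/-- **ONE STEP OF MARKOV DAMPING.**  `B` isotone on the box with a LOWER SLOPE `μ` IN THE LEVEL OF AGE `0`, read at the upper level: for box configurations `u, v`
agreeing at all ages `≥ 1` with `v_0 ≤ u_0`, `B v + μ(1∕v_0²)·(1∕v_0² − 1∕u_0²) ≤ B u`.  Two box solutions `k` (from `z`) and `k′ ≤ k` (from `z′`) then satisfy
`(1∕k′_{j+1}² − 1∕k_{j+1}²)·(1 + μ(1∕k′_{j+1}²)) ≤ 1∕k′_j² − 1∕k_j²`: the gap recursion is `g_{j+1} = g_j + B(tail_{j+1}k′) − B(tail_{j+1}k)`, and passing from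
`tail_{j+1}k′` to `tail_{j+1}k` through the configuration with the age-`0` coupling of `k` and the older couplings of `k′` costs at least `μ·g_{j+1}` at age `0`
(lower slope) and a non-negative amount at the older ages (isotonicity). [folklore] -/
theorem markov_gap_step
    (hmono : ∀ u v : ℕ → ℝ, SeqBox γ u → SeqBox γ v → (∀ i, u i ≤ v i) → B u ≤ B v)
    (hMk : ∀ u v : ℕ → ℝ, SeqBox γ u → SeqBox γ v → (∀ i, u (i + 1) = v (i + 1)) → v 0 ≤ u 0 →
      B v + μ (1 / v 0 ^ 2) * (1 / v 0 ^ 2 - 1 / u 0 ^ 2) ≤ B u)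
    {k k' : ℕ → ℝ} {z z' : ℝ} (hk : SeqBox γ k) (hfk : MemFlow B z k) (hk' : SeqBox γ k') (hfk' : MemFlow B z' k')
    (hle : ∀ i, k' i ≤ k i) (j : ℕ) :
    (1 / k' (j + 1) ^ 2 - 1 / k (j + 1) ^ 2) * (1 + μ (1 / k' (j + 1) ^ 2)) ≤ 1 / k' j ^ 2 - 1 / k j ^ 2 := by
  have h1 : 1 / k (j + 1) ^ 2 = 1 / k j ^ 2 + B (fun i => k (j + 1 + i)) := hfk.2 j
  have h2 : 1 / k' (j + 1) ^ 2 = 1 / k' j ^ 2 + B (fun i => k' (j + 1 + i)) := hfk'.2 j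
  -- the mixed configuration: age 0 from k, older ages from k′
  set w : ℕ → ℝ := fun i => if i = 0 then k (j + 1) else k' (j + 1 + i) with hw
  have hwbox : SeqBox γ w := by
    intro i
    by_cases hi : i = 0
    · simp only [hw, hi, if_true]; exact hk (j + 1)
    · simp only [hw, hi, if_false]; exact hk' (j + 1 + i)
  have hw0 : w 0 = k (j + 1) := by simp [hw]
  have hwS : ∀ i, w (i + 1) = k' (j + 1 + (i + 1)) := fun i => by simp [hw]
  -- age 0: lower slope between tail k′ (coupling k′_{j+1}) and w (coupling k_{j+1} ≥ k′_{j+1})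
  have hA := hMk w (fun i => k' (j + 1 + i)) hwbox (seqBox_shift hk' (j + 1)) (fun i => by rw [hwS i]) (by
    rw [hw0]; simpa using hle (j + 1))
  simp only [Nat.add_zero] at hA
  rw [hw0] at hA
  -- older ages: w ≤ tail k componentwise
  have hB2 : B w ≤ B (fun i => k (j + 1 + i)) := by
    refine hmono _ _ hwbox (seqBox_shift hk (j + 1)) fun i => ?_
    by_cases hi : i = 0
    · subst hi; simp [hw]
    · simp only [hw, hi, if_false]; exact hle _
  have e : (1 / k' (j + 1) ^ 2 - 1 / k (j + 1) ^ 2) * (1 + μ (1 / k' (j + 1) ^ 2))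
      = (1 / k' (j + 1) ^ 2 - 1 / k (j + 1) ^ 2) + μ (1 / k' (j + 1) ^ 2) * (1 / k' (j + 1) ^ 2 - 1 / k (j + 1) ^ 2) := by ring
  rw [e]
  linarith [hA, hB2, h1, h2]

/-- **MARKOV DAMPING OF THE BASE FAMILY.**  In addition let `μ ≥ 0` be ANTITONE in the level and `B ≤ β̄` on the box (`β̄ ≥ 0`).  Then for the two solutions of
`markov_gap_step` with `k′ ≤ k` and every scale `j` whose level ceiling `1∕z′² + j·β̄` stays below `Ā`:  `1∕k′_j² − 1∕k_j² ≤ (1+μ(Ā))^{−j}·(1∕z′² − 1∕z²)` — the pin gap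
is contracted by at least `(1+μ(Ā))⁻¹` per scale as long as the levels stay below `Ā` (there `μ ≥ μ(Ā)`). [folklore] -/
theorem markov_gap_le (hμ0 : ∀ A, 0 ≤ μ A) (hμanti : Antitone μ)
    (hmono : ∀ u v : ℕ → ℝ, SeqBox γ u → SeqBox γ v → (∀ i, u i ≤ v i) → B u ≤ B v)
    (hbddB : ∀ u, SeqBox γ u → B u ≤ βb) (hβb : 0 ≤ βb)
    (hMk : ∀ u v : ℕ → ℝ, SeqBox γ u → SeqBox γ v → (∀ i, u (i + 1) = v (i + 1)) → v 0 ≤ u 0 →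
      B v + μ (1 / v 0 ^ 2) * (1 / v 0 ^ 2 - 1 / u 0 ^ 2) ≤ B u)
    {k k' : ℕ → ℝ} {z z' : ℝ} (hk : SeqBox γ k) (hfk : MemFlow B z k) (hk' : SeqBox γ k') (hfk' : MemFlow B z' k')
    (hle : ∀ i, k' i ≤ k i) {Abar : ℝ} :
    ∀ j : ℕ, 1 / z' ^ 2 + (j : ℝ) * βb ≤ Abar →
      1 / k' j ^ 2 - 1 / k j ^ 2 ≤ ((1 + μ Abar)⁻¹) ^ j * (1 / z' ^ 2 - 1 / z ^ 2)
  | 0 => fun _ => by rw [hfk.1, hfk'.1]; simp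
  | j + 1 => fun hceil => by
    have hceil' : 1 / z' ^ 2 + (j : ℝ) * βb ≤ Abar := by push_cast at hceil; nlinarith
    have ih := markov_gap_le hμ0 hμanti hmono hbddB hβb hMk hk hfk hk' hfk' hle j hceil'
    have hstep := markov_gap_step hmono hMk hk hfk hk' hfk' hle j
    -- the gap at scale j+1 is non-negative
    have hp : 0 < k (j + 1) := (hk (j + 1)).1
    have hp' : 0 < k' (j + 1) := (hk' (j + 1)).1
    have hg0 : 0 ≤ 1 / k' (j + 1) ^ 2 - 1 / k (j + 1) ^ 2 :=
      sub_nonneg.mpr (one_div_le_one_div_of_le (pow_pos hp' 2) (pow_le_pow_left₀ hp'.le (hle (j + 1)) 2))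
    -- the level at scale j+1 of k′ is below the ceiling, so μ there is at least μ(Ā)
    have hlev : 1 / k' (j + 1) ^ 2 ≤ Abar := by
      have := level_le_pin_add hbddB hk' hfk' (j + 1)
      push_cast at this hceil; linarith
    have hμle : μ Abar ≤ μ (1 / k' (j + 1) ^ 2) := hμanti hlev
    have hd0 : 0 < 1 + μ Abar := by linarith [hμ0 Abar]
    have hkey : (1 / k' (j + 1) ^ 2 - 1 / k (j + 1) ^ 2) * (1 + μ Abar) ≤ 1 / k' j ^ 2 - 1 / k j ^ 2 :=
      (mul_le_mul_of_nonneg_left (by linarith) hg0).trans hstep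
    have hdiv : 1 / k' (j + 1) ^ 2 - 1 / k (j + 1) ^ 2 ≤ (1 + μ Abar)⁻¹ * (1 / k' j ^ 2 - 1 / k j ^ 2) := by
      rw [inv_mul_eq_div]; exact (le_div_iff₀ hd0).mpr hkey
    have hinv0 : 0 ≤ (1 + μ Abar)⁻¹ := inv_nonneg.mpr hd0.le
    calc 1 / k' (j + 1) ^ 2 - 1 / k (j + 1) ^ 2 ≤ (1 + μ Abar)⁻¹ * (1 / k' j ^ 2 - 1 / k j ^ 2) := hdiv
      _ ≤ (1 + μ Abar)⁻¹ * (((1 + μ Abar)⁻¹) ^ j * (1 / z' ^ 2 - 1 / z ^ 2)) := mul_le_mul_of_nonneg_left ih hinv0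
      _ = ((1 + μ Abar)⁻¹) ^ (j + 1) * (1 / z' ^ 2 - 1 / z ^ 2) := by ring


/-! ## §3 The window gaps are bounded by the DAMPED positive parts of the dual steps -/

/-- **DAMPED WINDOW GAPS.**  Base package (isotone, floor `b > 0`, modulus, `B ≤ β̄`, unique box solutions `S q`) with the Markov lower slope `μ` (antitone, `≥ 0`);
`h′` ANY box sequence whose level grows by at most `β̄` per scale.  With the dual steps `X_m = 1∕h′_{m+1}² − 1∕(S h′_m)_1²` and `d = (1+μ(Ā))⁻¹`, the age-`k` window gap
above the pin `h′_n` satisfies `1∕h′_{n+1+k}² − 1∕(S h′_n)_{1+k}² ≤ Σ_{l≤k} d^{k−l}·X⁺_{n+l}` whenever the window's level ceiling `1∕h′_{n+1}² + k·β̄` stays below `Ā`: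
telescope through the base orbits restarted at the intermediate points ((E138a) `gap_le_sum_parts`) and damp the pin gap `X_{n+l}`, read `k − l` scales later, by
`markov_gap_le` (a negative pin gap contributes `≤ 0`). [folklore] -/
theorem gap_le_sum_damped (hb : 0 < b) (hμ0 : ∀ A, 0 ≤ μ A) (hμanti : Antitone μ)
    (hmono : ∀ u v : ℕ → ℝ, SeqBox γ u → SeqBox γ v → (∀ i, u i ≤ v i) → B u ≤ B v)
    (hB : ∀ u u' : ℕ → ℝ, SeqBox γ u → SeqBox γ u' → ∀ D : ℝ, (∀ j, |u j - u' j| ≤ D) → |B u - B u'| ≤ M * D) (hM : 0 ≤ M)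
    (hlo : ∀ u, SeqBox γ u → b ≤ B u) (hbddB : ∀ u, SeqBox γ u → B u ≤ βb) (hβb : 0 ≤ βb)
    (hMk : ∀ u v : ℕ → ℝ, SeqBox γ u → SeqBox γ v → (∀ i, u (i + 1) = v (i + 1)) → v 0 ≤ u 0 →
      B v + μ (1 / v 0 ^ 2) * (1 / v 0 ^ 2 - 1 / u 0 ^ 2) ≤ B u)
    (hS : ∀ p, 0 < p → p ≤ γ → SeqBox γ (S p) ∧ MemFlow B p (S p))
    (huniq : ∀ p, 0 < p → p ≤ γ → ∀ u u' : ℕ → ℝ, SeqBox γ u → SeqBox γ u' → MemFlow B p u → MemFlow B p u' → u = u')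
    (hh' : SeqBox γ h') (hgrow : ∀ n, 1 / h' (n + 1) ^ 2 ≤ 1 / h' n ^ 2 + βb) {Abar : ℝ} :
    ∀ k n : ℕ, 1 / h' (n + 1) ^ 2 + (k : ℝ) * βb ≤ Abar →
      1 / h' (n + 1 + k) ^ 2 - 1 / S (h' n) (1 + k) ^ 2
        ≤ ∑ l ∈ range (k + 1), ((1 + μ Abar)⁻¹) ^ (k - l) * max (1 / h' (n + l + 1) ^ 2 - 1 / S (h' (n + l)) 1 ^ 2) 0 := by
  have hd0 : 0 ≤ (1 + μ Abar)⁻¹ := inv_nonneg.mpr (by linarith [hμ0 Abar])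
  intro k
  induction k with
  | zero =>
    intro n _
    rw [zero_add, sum_range_one]
    simp only [add_zero, Nat.sub_zero, pow_zero, one_mul]
    exact le_max_left _ _
  | succ k ih =>
    intro n hceil
    have hpn := hh' n
    have hq1 := hh' (n + 1)
    have hq2m := family_mem hS hpn.1 hpn.2 1
    have hS1 := hS _ hq1.1 hq1.2
    have hS2 := hS _ hq2m.1 hq2m.2
    -- autonomy: the base orbit from h′_n beyond scale 1 is the base orbit from (S h′_n)_1
    have e2 : S (h' n) (1 + (k + 1)) = S (S (h' n) 1) (1 + k) := by
      have := congrFun (family_tail_eq hS huniq hpn.1 hpn.2 1) (1 + k)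
      simpa [Nat.add_comm, Nat.add_assoc] using this
    have e1 : n + 1 + (k + 1) = (n + 1) + 1 + k := by omega
    have hceil' : 1 / h' (n + 1 + 1) ^ 2 + (k : ℝ) * βb ≤ Abar := by
      have := hgrow (n + 1); push_cast at hceil ⊢; linarith
    have ihn := ih (n + 1) hceil'
    -- the bracket: base orbits from the pins h′_{n+1} and (S h′_n)_1, read 1+k scales later, damped
    have hbr : 1 / S (h' (n + 1)) (1 + k) ^ 2 - 1 / S (S (h' n) 1) (1 + k) ^ 2
        ≤ ((1 + μ Abar)⁻¹) ^ (k + 1) * max (1 / h' (n + 1) ^ 2 - 1 / S (h' n) 1 ^ 2) 0 := by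
      rcases le_or_gt (h' (n + 1)) (S (h' n) 1) with hle | hlt
      · have hcomp : ∀ i, S (h' (n + 1)) i ≤ S (S (h' n) 1) i := fun i =>
          le_of_pin_le hb hB hM hlo huniq hq1.1 hle hq2m.2 hS1.1 hS2.1 hS1.2 hS2.2 i
        have hmk := markov_gap_le hμ0 hμanti hmono hbddB hβb hMk hS2.1 hS2.2 hS1.1 hS1.2 hcomp (Abar := Abar) (1 + k)
          (by push_cast at hceil ⊢; linarith)
        have hX0 : 0 ≤ 1 / h' (n + 1) ^ 2 - 1 / S (h' n) 1 ^ 2 :=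
          sub_nonneg.mpr (one_div_le_one_div_of_le (pow_pos hq1.1 2) (pow_le_pow_left₀ hq1.1.le hle 2))
        rw [max_eq_left hX0, show k + 1 = 1 + k by omega]
        exact hmk
      · have hcomp : ∀ i, S (S (h' n) 1) i ≤ S (h' (n + 1)) i := fun i =>
          le_of_pin_le hb hB hM hlo huniq hq2m.1 hlt.le hq1.2 hS2.1 hS1.1 hS2.2 hS1.2 i
        have hpa : 0 < S (S (h' n) 1) (1 + k) := (hS2.1 (1 + k)).1
        have h0 : 1 / S (h' (n + 1)) (1 + k) ^ 2 - 1 / S (S (h' n) 1) (1 + k) ^ 2 ≤ 0 :=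
          sub_nonpos.mpr (one_div_le_one_div_of_le (pow_pos hpa 2) (pow_le_pow_left₀ hpa.le (hcomp (1 + k)) 2))
        have : 0 ≤ ((1 + μ Abar)⁻¹) ^ (k + 1) * max (1 / h' (n + 1) ^ 2 - 1 / S (h' n) 1 ^ 2) 0 :=
          mul_nonneg (pow_nonneg hd0 _) (le_max_right _ _)
        linarith
    -- reindex the damped sum
    have hre : ∑ l ∈ range (k + 1 + 1), ((1 + μ Abar)⁻¹) ^ (k + 1 - l) * max (1 / h' (n + l + 1) ^ 2 - 1 / S (h' (n + l)) 1 ^ 2) 0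
        = ∑ l ∈ range (k + 1), ((1 + μ Abar)⁻¹) ^ (k - l) * max (1 / h' (n + 1 + l + 1) ^ 2 - 1 / S (h' (n + 1 + l)) 1 ^ 2) 0
          + ((1 + μ Abar)⁻¹) ^ (k + 1) * max (1 / h' (n + 1) ^ 2 - 1 / S (h' n) 1 ^ 2) 0 := by
      rw [sum_range_succ']
      congr 1
      · refine sum_congr rfl fun l hl => ?_
        have hl' : l < k + 1 := mem_range.mp hl
        rw [show k + 1 - (l + 1) = k - l by omega, show n + (l + 1) + 1 = n + 1 + l + 1 by omega,
          show n + (l + 1) = n + 1 + l by omega]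
    rw [e1, e2, hre]
    linarith [ihn, hbr]

/-! ## §4 The Markov credit on one dual step -/

/-- **THE MARKOV CREDIT.**  Base package with the Markov lower slope `μ`; `h′` a box solution of ANY `B′` from a pin in `]0,γ]`.  If the dual steps are non-negative at
every row from `n` on (so that the perturbed tail is ahead of the base restarted at `h′_n`, (E132) `cmp_of_dual_steps_nonneg`), then the dual step at row `n` carries
the credit of the age-`0` slope: `(1 + μ(1∕h′_{n+1}²))·X_n ≤ E_n := (B′−B)(tail_{n+1}h′)` — pass from `tail_1 S h′_n` to `tail_{n+1}h′` through the configuration with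
the perturbed coupling at age `0` and the base's older ones: the age-`0` move costs at least `μ·X_n` (lower slope), the older moves cost a non-negative amount
(comparison + isotonicity). [folklore] -/
theorem credit_step_le (hb : 0 < b)
    (hmono : ∀ u v : ℕ → ℝ, SeqBox γ u → SeqBox γ v → (∀ i, u i ≤ v i) → B u ≤ B v)
    (hB : ∀ u u' : ℕ → ℝ, SeqBox γ u → SeqBox γ u' → ∀ D : ℝ, (∀ j, |u j - u' j| ≤ D) → |B u - B u'| ≤ M * D) (hM : 0 ≤ M)
    (hlo : ∀ u, SeqBox γ u → b ≤ B u)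
    (hMk : ∀ u v : ℕ → ℝ, SeqBox γ u → SeqBox γ v → (∀ i, u (i + 1) = v (i + 1)) → v 0 ≤ u 0 →
      B v + μ (1 / v 0 ^ 2) * (1 / v 0 ^ 2 - 1 / u 0 ^ 2) ≤ B u)
    (hS : ∀ p, 0 < p → p ≤ γ → SeqBox γ (S p) ∧ MemFlow B p (S p))
    (huniq : ∀ p, 0 < p → p ≤ γ → ∀ u u' : ℕ → ℝ, SeqBox γ u → SeqBox γ u' → MemFlow B p u → MemFlow B p u' → u = u')
    (hh' : SeqBox γ h') {y : ℝ} (hf' : MemFlow B' y h') (n : ℕ)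
    (hX : ∀ i, 0 ≤ 1 / h' (n + i + 1) ^ 2 - 1 / S (h' (n + i)) 1 ^ 2) :
    (1 + μ (1 / h' (n + 1) ^ 2)) * (1 / h' (n + 1) ^ 2 - 1 / S (h' n) 1 ^ 2)
      ≤ B' (fun i => h' (n + 1 + i)) - B (fun i => h' (n + 1 + i)) := by
  have hpn := hh' n
  have hSn := hS (h' n) hpn.1 hpn.2
  -- comparison along the tail orbit from the pin h′_n
  have htailbox : SeqBox γ (fun i => h' (n + i)) := fun i => hh' (n + i)
  have htailflow : MemFlow B' (h' n) (fun i => h' (n + i)) := memFlow_tail hf' n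
  have hcmp : ∀ j, h' (n + j) ≤ S (h' n) j := by
    intro j
    have := cmp_of_dual_steps_nonneg (B' := B') hb hB hM hlo hS huniq hpn.1 hpn.2 htailbox htailflow j
      (fun i _ => by
        have h1 := hX i
        have heq := dual_step_eq_levels hS hh' hf' (n + i)
        have e : (fun i_1 => h' (n + (i + 1 + i_1))) = (fun i_1 => h' (n + i + 1 + i_1)) := by
          funext q; simp [Nat.add_assoc]
        rw [e]; linarith) j le_rfl
    simpa using this
  -- the three configurations
  set u : ℕ → ℝ := fun i => S (h' n) (1 + i) with hu
  set v : ℕ → ℝ := fun i => h' (n + 1 + i) with hv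
  set w : ℕ → ℝ := fun i => if i = 0 then h' (n + 1) else S (h' n) (1 + i) with hw
  have hubox : SeqBox γ u := fun i => hSn.1 (1 + i)
  have hvbox : SeqBox γ v := fun i => hh' (n + 1 + i)
  have hwbox : SeqBox γ w := by
    intro i
    by_cases hi : i = 0
    · simp only [hw, hi, if_true]; exact hh' (n + 1)
    · simp only [hw, hi, if_false]; exact hSn.1 (1 + i)
  have hw0 : w 0 = h' (n + 1) := by simp [hw]
  have hu0 : u 0 = S (h' n) 1 := by simp [hu]
  -- age 0: the lower slope between u (coupling (S h′_n)_1) and w (coupling h′_{n+1} ≤ (S h′_n)_1)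
  have hA := hMk u w hubox hwbox (fun i => by simp [hu, hw]) (by rw [hw0, hu0]; simpa using hcmp 1)
  rw [hw0, hu0] at hA
  -- older ages: v ≤ w componentwise (comparison), so B v ≤ B w
  have hB2 : B v ≤ B w := by
    refine hmono _ _ hvbox hwbox fun i => ?_
    by_cases hi : i = 0
    · subst hi; simp [hv, hw]
    · obtain ⟨i', rfl⟩ := Nat.exists_eq_succ_of_ne_zero hi
      simp only [hv, hw, Nat.succ_ne_zero, if_false]
      have := hcmp (1 + (i' + 1))
      rw [show n + (1 + (i' + 1)) = n + 1 + (i' + 1) by omega] at this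
      exact this
  -- the dual step in functional form
  have heq := dual_step_eq_levels hS hh' hf' n
  have e : (1 + μ (1 / h' (n + 1) ^ 2)) * (1 / h' (n + 1) ^ 2 - 1 / S (h' n) 1 ^ 2)
      = (1 / h' (n + 1) ^ 2 - 1 / S (h' n) 1 ^ 2) + μ (1 / h' (n + 1) ^ 2) * (1 / h' (n + 1) ^ 2 - 1 / S (h' n) 1 ^ 2) := by ring
  rw [e]
  have hBu : B (fun i => S (h' n) (1 + i)) = B u := rfl
  have hBv : B (fun i => h' (n + 1 + i)) = B v := rfl
  linarith [hA, hB2, heq]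

/-! ## §5 Deep rows: every graded profile with deep age moment below one -/

/-- Along a box solution of a functional with floor `b > 0` every level is eventually reached: `∃ N, A₀ ≤ 1∕h′_N²`. [folklore] -/
theorem exists_deep_row {b' : ℝ} (hb' : 0 < b') (hlo' : ∀ u, SeqBox γ u → b' ≤ B' u) (hh' : SeqBox γ h') {y : ℝ} (hf' : MemFlow B' y h')
    (A₀ : ℝ) : ∃ N : ℕ, A₀ ≤ 1 / h' N ^ 2 := by
  obtain ⟨N, hN⟩ := exists_nat_ge (A₀ / b')
  refine ⟨N, ?_⟩
  have h1 := level_ge_floor hb' hlo' hh' hf' N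
  have h2 : A₀ ≤ (N : ℝ) * b' := by rw [div_le_iff₀ hb'] at hN; linarith
  linarith

/-- **THE DUAL STEPS ARE NON-NEGATIVE FROM A DEEP ROW ON.**  Base package; a LEVEL-GRADED PROFILE `Λ_k(A) ≥ 0`: for every level `A` and box configurations `u, v` whose
age-`k` levels are `≥ A + (k+1)·b`, `B u − B v ≤ Σ_{k<K} Λ_k(A)·(1∕v_k² − 1∕u_k²)⁺`; `B ≤ B′ ≤ β̄` with isotone excess; `h′` a box solution of `B′` from a pin in `]0,γ]`.
If at the row `N` the age moment of the profile read at the orbit's own level is below one, `Σ_{k<K} k·Λ_k(1∕h′_N²) < 1`, then `X_n ≥ 0` for every `n ≥ N`: the tail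
`(h′_{N+i})_i` is a box solution in the SMALLER box `]0, h′_N]`, whose graded box is the graded box above the level `1∕h′_N²`, and (E138b) `dual_steps_sandwich` applies
there verbatim (the base family restricts to the smaller box since orbits decrease). [folklore] -/
theorem deep_steps_nonneg {Λ : ℕ → ℝ → ℝ} {K : ℕ} (hb : 0 < b)
    (hmono : ∀ u v : ℕ → ℝ, SeqBox γ u → SeqBox γ v → (∀ i, u i ≤ v i) → B u ≤ B v)
    (hB : ∀ u u' : ℕ → ℝ, SeqBox γ u → SeqBox γ u' → ∀ D : ℝ, (∀ j, |u j - u' j| ≤ D) → |B u - B u'| ≤ M * D) (hM : 0 ≤ M)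
    (hlo : ∀ u, SeqBox γ u → b ≤ B u)
    (hS : ∀ p, 0 < p → p ≤ γ → SeqBox γ (S p) ∧ MemFlow B p (S p))
    (huniq : ∀ p, 0 < p → p ≤ γ → ∀ u u' : ℕ → ℝ, SeqBox γ u → SeqBox γ u' → MemFlow B p u → MemFlow B p u' → u = u')
    (hΛ : ∀ k A, 0 ≤ Λ k A)
    (hLip : ∀ A : ℝ, ∀ u v : ℕ → ℝ, SeqBox γ u → SeqBox γ v → (∀ k : ℕ, A + ((k : ℝ) + 1) * b ≤ 1 / u k ^ 2) →
      (∀ k : ℕ, A + ((k : ℝ) + 1) * b ≤ 1 / v k ^ 2) → B u - B v ≤ ∑ k ∈ range K, Λ k A * max (1 / v k ^ 2 - 1 / u k ^ 2) 0)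
    (hexc : ∀ u, SeqBox γ u → B u ≤ B' u) (hbdd : ∀ u, SeqBox γ u → B' u ≤ βb)
    (hDmono : ∀ u v : ℕ → ℝ, SeqBox γ u → SeqBox γ v → (∀ i, u i ≤ v i) → B' u - B u ≤ B' v - B v)
    (hh' : SeqBox γ h') {y : ℝ} (hf' : MemFlow B' y h') (N : ℕ)
    (hθ : ∑ k ∈ range K, (k : ℝ) * Λ k (1 / h' N ^ 2) < 1) :
    ∀ n, N ≤ n → 0 ≤ 1 / h' (n + 1) ^ 2 - 1 / S (h' n) 1 ^ 2 := by
  intro n hn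
  obtain ⟨m, rfl⟩ := Nat.exists_eq_add_of_le hn
  have hlo' : ∀ u, SeqBox γ u → b ≤ B' u := fun u hu => (hlo u hu).trans (hexc u hu)
  have hanti : Antitone h' := (strictAnti_of_memFlow hb hlo' hh' hf').antitone
  -- the smaller box ]0, γ′], γ′ = h′_N
  have hγ' : 0 < h' N := (hh' N).1
  have hγ'γ : h' N ≤ γ := (hh' N).2
  have hh'' : SeqBox (h' N) (fun i => h' (N + i)) := fun i => ⟨(hh' (N + i)).1, hanti (Nat.le_add_right N i)⟩
  have hf'' : MemFlow B' (h' N) (fun i => h' (N + i)) := memFlow_tail hf' N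
  have hS' : ∀ p, 0 < p → p ≤ h' N → SeqBox (h' N) (S p) ∧ MemFlow B p (S p) := fun p hp hpγ' =>
    ⟨seqBox_of_le_pin (hS p hp (hpγ'.trans hγ'γ)).1 fun j =>
      (le_pin_of_memFlow hb hlo (hS p hp (hpγ'.trans hγ'γ)).1 (hS p hp (hpγ'.trans hγ'γ)).2 j).trans hpγ',
     (hS p hp (hpγ'.trans hγ'γ)).2⟩
  have hmono' : ∀ u v : ℕ → ℝ, SeqBox (h' N) u → SeqBox (h' N) v → (∀ i, u i ≤ v i) → B u ≤ B v :=
    fun u v hu hv huv => hmono u v (seqBox_mono hγ'γ hu) (seqBox_mono hγ'γ hv) huv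
  have hB'' : ∀ u u' : ℕ → ℝ, SeqBox (h' N) u → SeqBox (h' N) u' → ∀ D : ℝ, (∀ j, |u j - u' j| ≤ D) → |B u - B u'| ≤ M * D :=
    fun u u' hu hu' D hD => hB u u' (seqBox_mono hγ'γ hu) (seqBox_mono hγ'γ hu') D hD
  have hlo'' : ∀ u, SeqBox (h' N) u → b ≤ B u := fun u hu => hlo u (seqBox_mono hγ'γ hu)
  have huniq' : ∀ p, 0 < p → p ≤ h' N → ∀ u u' : ℕ → ℝ, SeqBox (h' N) u → SeqBox (h' N) u' →
      MemFlow B p u → MemFlow B p u' → u = u' :=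
    fun p hp hpγ' u u' hu hu' hfu hfu' => huniq p hp (hpγ'.trans hγ'γ) u u' (seqBox_mono hγ'γ hu) (seqBox_mono hγ'γ hu') hfu hfu'
  have hexc' : ∀ u, SeqBox (h' N) u → B u ≤ B' u := fun u hu => hexc u (seqBox_mono hγ'γ hu)
  have hbdd' : ∀ u, SeqBox (h' N) u → B' u ≤ βb := fun u hu => hbdd u (seqBox_mono hγ'γ hu)
  have hDmono' : ∀ u v : ℕ → ℝ, SeqBox (h' N) u → SeqBox (h' N) v → (∀ i, u i ≤ v i) → B' u - B u ≤ B' v - B v :=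
    fun u v hu hv huv => hDmono u v (seqBox_mono hγ'γ hu) (seqBox_mono hγ'γ hv) huv
  have hLip' : ∀ u v : ℕ → ℝ, SeqBox (h' N) u → SeqBox (h' N) v → (∀ k : ℕ, 1 / h' N ^ 2 + ((k : ℝ) + 1) * b ≤ 1 / u k ^ 2) →
      (∀ k : ℕ, 1 / h' N ^ 2 + ((k : ℝ) + 1) * b ≤ 1 / v k ^ 2) →
      B u - B v ≤ ∑ k ∈ range K, (fun k => Λ k (1 / h' N ^ 2)) k * max (1 / v k ^ 2 - 1 / u k ^ 2) 0 :=
    fun u v hu hv hgu hgv => hLip (1 / h' N ^ 2) u v (seqBox_mono hγ'γ hu) (seqBox_mono hγ'γ hv) hgu hgv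
  have hsw := (dual_steps_sandwich (B := B) (B' := B') (γ := h' N) (S := S) (h' := fun i => h' (N + i)) hb hmono' hB'' hM hlo''
    hS' huniq' (Λ := fun k => Λ k (1 / h' N ^ 2)) (fun k => hΛ k _) hθ hLip' hexc' hbdd' hDmono' hh'' hγ' le_rfl hf'' m).1
  simpa [Nat.add_assoc] using hsw

end Summit.QuantumFields.BalabanUV.Beta.EriceRemainderEnclosureHistoryAutonomyComparisonMarkovCreditLinks

end
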